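import Summits.KontsevichZagierPeriods.KontsevichZagierPeriods.Theorems.SymplecticScissorsVolumeFormOffPlaneScissors
import Summits.KontsevichZagierPeriods.KontsevichZagierPeriods.Theorems.SymplecticScissorsVolumeFormOffPlanePairsOfDecomposition
import Summits.KontsevichZagierPeriods.KontsevichZagierPeriods.Theorems.HyperbolicBlochOffTetraSectorKernelStubAffineOrbit
import Literature.NumberTheory.Transcendental.KZDirichletPeeling

/-!
# `VolumeFormOffPlane` (stmt-KontsevichZagierPeriods-14935) — line `Sketch`:
AFFINE-ORBIT PAIRS and ALGEBRAIC-SIMPLEX PAIRS (the Euclidean polytope sector, every dimension)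

The line's signed-scissors layer (`stub_scissors`, `stub_pairsOfDecomposition`) is not tied to
the torus. Fed with the Euclidean affine sector of the `OffTetraSectorKernel` line
(`…HyperbolicBloch.OffTetraSectorKernel.stub_affineOrbit`: a `ℤ`-linear relation among the
volumes of real-algebraic affine images `Aᵢ B + bᵢ` of ONE `ℚ`-semialgebraic body `B` is a KZ
relation) it gives, in every dimension `d`:

* `affineOrbitPairs` — two integrand-`1` representations whose domains are, almost everywhere,
  `ℤ`-combinations of indicators of real-algebraic affine images of one body `B` of finite
  volume, and whose values agree, are KZ-equivalent;
* `algebraicSimplexPairs` — the instance `B = Δ_d` (open corner simplex): a.e. signed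
  combinations of open simplices with REAL ALGEBRAIC vertices, i.e. every finite union of
  polytopes with real algebraic vertices once a signed triangulation is written down. Volume is
  the only obstruction: Hilbert's third problem has no Dehn invariant in the Kontsevich–Zagier
  calculus, in every dimension (the frame `VolumeForm` on the algebraic polytope sector; for
  `d ≥ 3` an instance of this crux).

Sources: Kontsevich–Zagier 2001, §1.2 (rules (1), (2)); Cresson–Viu-Sos 2022, §§3–4 (the
polytope / PL form of the geometric conjecture); folklore.
-/

noncomputable section

open MeasureTheory Set
open Literature.NumberTheory.Transcendental
open Literature.ModelTheory.ExponentialFields (IsSemialgebraic)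

namespace Summit.KontsevichZagierPeriods.SymplecticScissors.LogPolytope

/-- **Support restriction for the `ℤ`-weighted property.** If the weighted property of a class
holds for families all of whose members lie in the class, it holds for families whose members of
NON-ZERO weight lie in the class (restrict to the support and reindex it by `Fin`). [folklore] -/
theorem aop_weighted_of_forall {N : ℕ} (G : KZ.IntegralRep N → Prop)
    (h : ∀ (k : ℕ) (σ : Fin k → KZ.IntegralRep N) (w : Fin k → ℤ), (∀ j, G (σ j)) →
      ∑ j, (w j : ℝ) * (σ j).value = 0 → ∑ j, w j • KZ.of (σ j) ∈ KZ.relations) :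
    ∀ (k : ℕ) (σ : Fin k → KZ.IntegralRep N) (w : Fin k → ℤ), (∀ j, w j ≠ 0 → G (σ j)) →
      ∑ j, (w j : ℝ) * (σ j).value = 0 → ∑ j, w j • KZ.of (σ j) ∈ KZ.relations := by
  intro k σ w hG hv
  classical
  set s : Finset (Fin k) := Finset.univ.filter fun j => w j ≠ 0 with hs
  have hmem : ∀ {j}, j ∈ s ↔ w j ≠ 0 := by intro j; simp [hs]
  have hzero : ∀ {j}, j ∉ s → w j = 0 := fun hj => by
    by_contra h
    exact hj (hmem.mpr h)
  -- restrict both sums to the support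
  have hof : ∑ j, w j • KZ.of (σ j) = ∑ j ∈ s, w j • KZ.of (σ j) :=
    (Finset.sum_subset (Finset.subset_univ s) fun j _ hj => by simp [hzero hj]).symm
  have hval : ∑ j ∈ s, (w j : ℝ) * (σ j).value = 0 := by
    rw [← hv]
    exact Finset.sum_subset (Finset.subset_univ s) fun j _ hj => by simp [hzero hj]
  -- reindex the support by `Fin s.card`
  set e := s.equivFin with he
  have hsum_of : ∑ i : Fin s.card, w (e.symm i) • KZ.of (σ (e.symm i)) =
      ∑ j ∈ s, w j • KZ.of (σ j) := by
    rw [e.symm.sum_comp (fun x : s => w x • KZ.of (σ x)),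
      Finset.sum_coe_sort s (fun j => w j • KZ.of (σ j))]
  have hsum_val : ∑ i : Fin s.card, (w (e.symm i) : ℝ) * (σ (e.symm i)).value =
      ∑ j ∈ s, (w j : ℝ) * (σ j).value := by
    rw [e.symm.sum_comp (fun x : s => (w x : ℝ) * (σ x).value),
      Finset.sum_coe_sort s (fun j => (w j : ℝ) * (σ j).value)]
  have := h s.card (fun i => σ (e.symm i)) (fun i => w (e.symm i))
    (fun i => hG _ (hmem.mp (e.symm i).2)) (by rw [hsum_val, hval])
  rw [hsum_of] at this
  rwa [hof]

/-- **AFFINE-ORBIT PAIRS (every dimension).** Fix a `ℚ`-semialgebraic body `B ⊆ ℝᵈ` of finite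
volume. Two integrand-`1` representations of dimension `d` whose domains are, almost everywhere,
`ℤ`-combinations of indicators of domains of integrand-`1` representations on real-algebraic
affine images `A B + b` (`det A ≠ 0`; required where the weight is non-zero), and whose values
agree, are KZ-equivalent: `stub_pairsOfDecomposition` fed with `stub_scissors` and with the
Euclidean affine sector `OffTetraSectorKernel.stub_affineOrbit`. [folklore] -/
theorem affineOrbitPairs :
    ∀ (d : ℕ) (B : Set (Fin d → ℝ)), IsSemialgebraic ℚ B → volume B ≠ ⊤ →
      ∀ (r r' : KZ.IntegralRep d) (k k' : ℕ) (ρ : Fin k → KZ.IntegralRep d)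
        (ρ' : Fin k' → KZ.IntegralRep d) (c : Fin k → ℤ) (c' : Fin k' → ℤ),
      (∀ x ∈ r.domain, r.integrand x = 1) → (∀ x ∈ r'.domain, r'.integrand x = 1) →
      (∀ i, ∀ x ∈ (ρ i).domain, (ρ i).integrand x = 1) →
      (∀ i, ∀ x ∈ (ρ' i).domain, (ρ' i).integrand x = 1) →
      (∀ i, c i ≠ 0 → ∃ (A : Matrix (Fin d) (Fin d) ℝ) (b : Fin d → ℝ),
        (∀ j l, IsAlgebraic ℚ (A j l)) ∧ (∀ j, IsAlgebraic ℚ (b j)) ∧ A.det ≠ 0 ∧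
        (ρ i).domain = (fun x => A.mulVec x + b) '' B) →
      (∀ i, c' i ≠ 0 → ∃ (A : Matrix (Fin d) (Fin d) ℝ) (b : Fin d → ℝ),
        (∀ j l, IsAlgebraic ℚ (A j l)) ∧ (∀ j, IsAlgebraic ℚ (b j)) ∧ A.det ≠ 0 ∧
        (ρ' i).domain = (fun x => A.mulVec x + b) '' B) →
      (∀ᵐ x : Fin d → ℝ, r.domain.indicator (fun _ => (1 : ℝ)) x =
        ∑ i, (c i : ℝ) * (ρ i).domain.indicator (fun _ => (1 : ℝ)) x) →
      (∀ᵐ x : Fin d → ℝ, r'.domain.indicator (fun _ => (1 : ℝ)) x =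
        ∑ i, (c' i : ℝ) * (ρ' i).domain.indicator (fun _ => (1 : ℝ)) x) →
      r.value = r'.value → KZ.Equivalent r r' := by
  intro d B hB hBvol r r' k k' ρ ρ' c c' hr hr' hρ hρ' hc hc' hdec hdec' hval
  -- the class: integrand 1 on a real-algebraic affine image of `B`
  have hW : ∀ (K : ℕ) (σ : Fin K → KZ.IntegralRep d) (w : Fin K → ℤ),
      (∀ j, w j ≠ 0 → (∀ x ∈ (σ j).domain, (σ j).integrand x = 1) ∧
        ∃ (A : Matrix (Fin d) (Fin d) ℝ) (b : Fin d → ℝ),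
          (∀ j l, IsAlgebraic ℚ (A j l)) ∧ (∀ j, IsAlgebraic ℚ (b j)) ∧ A.det ≠ 0 ∧
          (σ j).domain = (fun x => A.mulVec x + b) '' B) →
      ∑ j, (w j : ℝ) * (σ j).value = 0 → ∑ j, w j • KZ.of (σ j) ∈ KZ.relations := by
    refine aop_weighted_of_forall (N := d)
      (fun τ => (∀ x ∈ τ.domain, τ.integrand x = 1) ∧
        ∃ (A : Matrix (Fin d) (Fin d) ℝ) (b : Fin d → ℝ),
          (∀ j l, IsAlgebraic ℚ (A j l)) ∧ (∀ j, IsAlgebraic ℚ (b j)) ∧ A.det ≠ 0 ∧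
          τ.domain = (fun x => A.mulVec x + b) '' B)
      fun K σ w hG hv => ?_
    choose hone A b hA hb hdet hdom using hG
    exact Summit.KontsevichZagierPeriods.HyperbolicBloch.OffTetraSectorKernel.stub_affineOrbit
      d K B A b w σ hB hBvol (fun i j l => hA i j l) (fun i j => hb i j) hdet hdom hone hv
  refine stub_pairsOfDecomposition d
    (fun τ => (∀ x ∈ τ.domain, τ.integrand x = 1) ∧
      ∃ (A : Matrix (Fin d) (Fin d) ℝ) (b : Fin d → ℝ),
        (∀ j l, IsAlgebraic ℚ (A j l)) ∧ (∀ j, IsAlgebraic ℚ (b j)) ∧ A.det ≠ 0 ∧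
        τ.domain = (fun x => A.mulVec x + b) '' B)
    (fun _ => False) (stub_scissors d) ?_
    r r' k 0 k' 0 ρ (fun ν => ν.elim0) ρ' (fun ν => ν.elim0) c (fun ν => ν.elim0)
    c' (fun ν => ν.elim0) hr hr' hρ (fun ν => ν.elim0) hρ' (fun ν => ν.elim0)
    (fun i hi => ⟨hρ i, hc i hi⟩) (fun ν => ν.elim0) (fun i hi => ⟨hρ' i, hc' i hi⟩)
    (fun ν => ν.elim0) (by simpa using hdec) (by simpa using hdec') hval
  intro K M ρB ρS cB cS hBG hS hv
  have hcS : ∀ ν, cS ν = 0 := fun ν => by_contra fun h => hS ν h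
  simp only [hcS, Int.cast_zero, zero_mul, Finset.sum_const_zero, add_zero, zero_smul] at hv ⊢
  exact hW K ρB cB hBG hv

/-- **ALGEBRAIC-SIMPLEX PAIRS (Hilbert's third problem has no obstruction in the KZ calculus,
every dimension).** Two integrand-`1` representations of dimension `d` whose domains are, almost
everywhere, `ℤ`-combinations of indicators of domains of integrand-`1` representations on open
simplices with real algebraic vertices — written as affine images `A Δ_d + b` of the open corner
simplex `Δ_d = {x | (∀ i, 0 < x i) ∧ ∑ x i < 1}` with `A`, `b` real algebraic, `det A ≠ 0` — and
whose values agree are KZ-equivalent. Every finite union of polytopes with real algebraic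
vertices admits such a signed (indeed a genuine) triangulation. [folklore] -/
theorem algebraicSimplexPairs :
    ∀ (d : ℕ) (r r' : KZ.IntegralRep d) (k k' : ℕ) (ρ : Fin k → KZ.IntegralRep d)
        (ρ' : Fin k' → KZ.IntegralRep d) (c : Fin k → ℤ) (c' : Fin k' → ℤ),
      (∀ x ∈ r.domain, r.integrand x = 1) → (∀ x ∈ r'.domain, r'.integrand x = 1) →
      (∀ i, ∀ x ∈ (ρ i).domain, (ρ i).integrand x = 1) →
      (∀ i, ∀ x ∈ (ρ' i).domain, (ρ' i).integrand x = 1) →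
      (∀ i, c i ≠ 0 → ∃ (A : Matrix (Fin d) (Fin d) ℝ) (b : Fin d → ℝ),
        (∀ j l, IsAlgebraic ℚ (A j l)) ∧ (∀ j, IsAlgebraic ℚ (b j)) ∧ A.det ≠ 0 ∧
        (ρ i).domain = (fun x => A.mulVec x + b) ''
          {x : Fin d → ℝ | (∀ i, 0 < x i) ∧ ∑ i, x i < 1}) →
      (∀ i, c' i ≠ 0 → ∃ (A : Matrix (Fin d) (Fin d) ℝ) (b : Fin d → ℝ),
        (∀ j l, IsAlgebraic ℚ (A j l)) ∧ (∀ j, IsAlgebraic ℚ (b j)) ∧ A.det ≠ 0 ∧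
        (ρ' i).domain = (fun x => A.mulVec x + b) ''
          {x : Fin d → ℝ | (∀ i, 0 < x i) ∧ ∑ i, x i < 1}) →
      (∀ᵐ x : Fin d → ℝ, r.domain.indicator (fun _ => (1 : ℝ)) x =
        ∑ i, (c i : ℝ) * (ρ i).domain.indicator (fun _ => (1 : ℝ)) x) →
      (∀ᵐ x : Fin d → ℝ, r'.domain.indicator (fun _ => (1 : ℝ)) x =
        ∑ i, (c' i : ℝ) * (ρ' i).domain.indicator (fun _ => (1 : ℝ)) x) →
      r.value = r'.value → KZ.Equivalent r r' := by
  intro d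
  refine affineOrbitPairs d _ (KZ.isSemialgebraic_dirichletSimplex d) ?_
  -- the open corner simplex sits in the unit cube, hence has finite volume
  refine ((measure_mono fun x hx => ?_).trans_lt
    (isCompact_Icc (a := (0 : Fin d → ℝ)) (b := 1)).measure_lt_top).ne
  simp only [mem_setOf_eq] at hx
  refine ⟨fun i => (hx.1 i).le, fun i => ?_⟩
  have hle : x i ≤ ∑ j, x j :=
    Finset.single_le_sum (f := x) (fun j _ => (hx.1 j).le) (Finset.mem_univ i)
  exact (hle.trans hx.2.le)

end Summit.KontsevichZagierPeriods.SymplecticScissors.LogPolytope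

end
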